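import Summits.ResolutionOfSingularities.KangarooAtlas.MizutaniRank
import HarnessLib

/-!
# Mizutani's conjecture `m(e) = 2p^e − 1` — Lemma 1.5 and THEOREM F for the box-truncated Hasse–Schmidt system

Cell topic `Summits/ResolutionOfSingularities/KangarooAtlas` (pub-rosobs); namespace
`Summit.ResolutionOfSingularities.KangarooAtlas.Mizutani`.  Part of the Lean transcription of the
in-house note MIZUTANI-PROOF-g59 (AI-written, AI-audited; *AI review is weaker than expert review*; not a
resolution theorem).  Companion of `MizutaniRank`: the Hasse–Schmidt system of a purely inseparable tower is
TRUNCATED (`D^{(T)} = 0` outside the box, Leibniz only inside the box), so the intertwining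
`Ω ∘ (D_T ⊗ 1) = E_T ∘ Ω` holds only for `|T| + 1 ≤ q`; Lemma 1.5 uses no more.  This file records the box
forms `eProfile_succ_le_tensorRank_of_le`, `BoxTowerBridge`, `theoremF_rank_of_boxBridge` — the interface the
concrete tower `K = L(x^{1/q})` (`MizutaniRootTower`) instantiates.

References: [Mizutani1973HironakaGroupSchemes] (Remark 2.10; in-house proof §1.3–1.4, §9);
[Oda1983HironakaGroupSchemeII] §1 (p. 1166).
-/

open MvPolynomial TensorProduct

namespace Summit.ResolutionOfSingularities.KangarooAtlas.Mizutani

/-! ## Box-restricted versions (the form towers actually satisfy)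

The Hasse–Schmidt system of a purely inseparable tower is TRUNCATED: `D^{(T)} = 0` outside the box and the
Leibniz rule only holds for `T` in the box, so the intertwining `Ω ∘ (D_T ⊗ 1) = E_T ∘ Ω` is available only for
`|T| + 1 ≤ q` — which is all Lemma 1.5 uses.  The following variants record exactly that. -/

section BoxVersions

variable {L : Type*} {k : Type*} [Field L] [Field k] [Algebra L k] {s : ℕ}

/-- **LEMMA 1.5, box form**: as `eProfile_succ_le_tensorRank`, but the intertwining of `D_T ⊗ 1` with `E_T`
is only required for `|T| + 1 ≤ q` (MIZUTANI-PROOF-g59 §1.4, Lemma 1.5).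
[cite: Mizutani1973HironakaGroupSchemes, Remark 2.10 (in-house proof §1.4, Lemma 1.5)] -/
theorem eProfile_succ_le_tensorRank_of_le [FiniteDimensional L k] (D : (Fin s →₀ ℕ) → k →ₗ[L] k)
    (Ω : k ⊗[L] k →ₗ[k] MvPolynomial (Fin s) k) {q : ℕ} (hq : 1 ≤ q)
    (hΩD : ∀ (T : Fin s →₀ ℕ) (ω : k ⊗[L] k), T.degree + 1 ≤ q →
      Ω (TensorProduct.map (D T) LinearMap.id ω) = opE (fun T => (D T).toAddMonoidHom) T (Ω ω))
    (hΩμ : ∀ ω : k ⊗[L] k, coeff 0 (Ω ω) = Algebra.TensorProduct.lmul'' L (S := k) ω)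
    (ω : k ⊗[L] k) (hω : ω ≠ 0) (hdeg : ∀ M ∈ (Ω ω).support, q ≤ M.degree) :
    eProfile (fun T => (D T).toAddMonoidHom) (q - 1) (Ω ω) + 1 ≤ tensorRank L ω := by
  classical
  set H := rightSupport L ω with hH
  set ι := H.subtype.baseChange k with hι
  set KH : Submodule k (k ⊗[L] k) := LinearMap.range ι with hKH
  set μ : k ⊗[L] k →ₗ[k] k := (Algebra.TensorProduct.lmul'' L (S := k)).toLinearMap with hμ
  set V : Submodule k (k ⊗[L] k) :=
    Submodule.span k ((fun T => TensorProduct.map (D T) LinearMap.id ω) '' (degLE (Fin s) (q - 1) : Set _))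
    with hV
  have hωKH : ω ∈ KH := mem_range_baseChange_rightSupport ω
  have hstab : ∀ (T : Fin s →₀ ℕ) (ξ : k ⊗[L] H), TensorProduct.map (D T) LinearMap.id (ι ξ) ∈ KH := by
    intro T ξ
    induction ξ using TensorProduct.induction_on with
    | zero => simp
    | tmul x h =>
      refine ⟨D T x ⊗ₜ h, ?_⟩
      rw [hι, LinearMap.baseChange_tmul, LinearMap.baseChange_tmul, TensorProduct.map_tmul]
      rfl
    | add x y hx hy => rw [map_add, map_add]; exact KH.add_mem hx hy
  have hVKH : V ≤ KH := by
    rw [hV, Submodule.span_le]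
    rintro _ ⟨T, -, rfl⟩
    obtain ⟨ξ, hξ⟩ := hωKH
    rw [← hξ]
    exact hstab T ξ
  have hVμ : V ≤ LinearMap.ker μ := by
    rw [hV, Submodule.span_le]
    rintro _ ⟨T, hT, rfl⟩
    have hTq : T.degree + 1 ≤ q := by
      have := mem_degLE.mp (Finset.mem_coe.mp hT); omega
    rw [SetLike.mem_coe, LinearMap.mem_ker, hμ, AlgHom.toLinearMap_apply, ← hΩμ, hΩD T ω hTq]
    refine coeff_zero_opE_eq_zero _ T _ fun M hM => ?_
    have := hdeg M hM
    omega
  have hHne : H ≠ ⊥ := by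
    intro hbot
    apply hω
    obtain ⟨ξ, hξ⟩ := hωKH
    have hsub : H.subtype = 0 := by
      ext x
      exact (Submodule.eq_bot_iff H).mp hbot x x.2
    rw [← hξ, hι, hsub, LinearMap.baseChange_zero, LinearMap.zero_apply]
  obtain ⟨h, hhH, hh0⟩ := (Submodule.ne_bot_iff H).mp hHne
  have hx : ι (h⁻¹ ⊗ₜ ⟨h, hhH⟩) ∉ LinearMap.ker μ := by
    rw [LinearMap.mem_ker, hι, LinearMap.baseChange_tmul, Submodule.subtype_apply, hμ,
      AlgHom.toLinearMap_apply]
    show Algebra.TensorProduct.lmul'' L (S := k) (h⁻¹ ⊗ₜ[L] h) ≠ 0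
    rw [show Algebra.TensorProduct.lmul'' L (S := k) (h⁻¹ ⊗ₜ[L] h) = h⁻¹ * h from rfl, inv_mul_cancel₀ hh0]
    exact one_ne_zero
  have hlt : V < KH := by
    refine lt_of_le_of_lt (le_inf hVKH hVμ) (lt_of_le_of_ne inf_le_left fun heq => hx ?_)
    have : ι (h⁻¹ ⊗ₜ ⟨h, hhH⟩) ∈ KH ⊓ LinearMap.ker μ := by rw [heq]; exact ⟨_, rfl⟩
    exact this.2
  have h1 : Module.finrank k V < Module.finrank k KH := Submodule.finrank_lt_finrank_of_lt hlt
  have h2 : Module.finrank k KH ≤ tensorRank L ω := by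
    calc Module.finrank k KH ≤ Module.finrank k (k ⊗[L] H) := LinearMap.finrank_range_le ι
      _ = Module.finrank L H := Module.finrank_baseChange
      _ = tensorRank L ω := rfl
  have h3 : eProfile (fun T => (D T).toAddMonoidHom) (q - 1) (Ω ω) ≤ Module.finrank k V := by
    have hle : eSpan (fun T => (D T).toAddMonoidHom) (q - 1) (Ω ω) ≤ V.map Ω := by
      unfold eSpan
      rw [Submodule.span_le]
      rintro _ ⟨T, hT, rfl⟩
      have hTq : T.degree + 1 ≤ q := by
        have := mem_degLE.mp (Finset.mem_coe.mp hT); omega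
      refine ⟨TensorProduct.map (D T) LinearMap.id ω, ?_, (hΩD T ω hTq)⟩
      exact Submodule.subset_span ⟨T, hT, rfl⟩
    unfold eProfile
    haveI : Module.Finite k V := inferInstance
    exact (Submodule.finrank_mono hle).trans (Submodule.finrank_map_le Ω V)
  omega

variable (L k) (p e s : ℕ)

/-- **The data a tower supplies, box form**: as `TowerBridge` but with the intertwining
`Ω ∘ (D_T ⊗ 1) = E_T ∘ Ω` only for `|T| + 1 ≤ p^e` (the truncated Hasse–Schmidt system of a purely inseparable
tower satisfies no more). [cite: Oda1983HironakaGroupSchemeII, §1 (p. 1166)] -/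
structure BoxTowerBridge where
  /-- the Hasse–Schmidt operators `D^{(T)}` of the tower -/
  D : (Fin s →₀ ℕ) → k →ₗ[L] k
  /-- the left `t`-coordinate map of `k ⊗_L k` -/
  Ω : k ⊗[L] k →ₗ[k] MvPolynomial (Fin s) k
  /-- `D^{(0)} = id` -/
  D_zero : D 0 = LinearMap.id
  /-- `Ω ∘ (D^{(T)} ⊗ 1) = E_T ∘ Ω` for `|T| + 1 ≤ q` -/
  Ω_map : ∀ (T : Fin s →₀ ℕ) (ω : k ⊗[L] k), T.degree + 1 ≤ p ^ e →
    Ω (TensorProduct.map (D T) LinearMap.id ω) = opE (fun T => (D T).toAddMonoidHom) T (Ω ω)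
  /-- the constant coefficient of `Ω` is the multiplication map `μ` -/
  Ω_coeff_zero : ∀ ω : k ⊗[L] k, coeff 0 (Ω ω) = Algebra.TensorProduct.lmul'' L (S := k) ω
  /-- `Ω` lands in the box `[0, p^e − 1]^s` -/
  Ω_box : ∀ (ω : k ⊗[L] k), ∀ M ∈ (Ω ω).support, InBox (p ^ e) M

variable {L k p e s}

/-- **THEOREM F, rank form (abstract over the box tower bridge)**: in a tower with `s ≥ 2` directions over an
infinite field of characteristic `p`, every GENUINE `ω` (left `t`-coordinates of degrees `≥ q = p^e` with a
genuine monomial, i.e. `ω ∈ J^q ∖ I_S`) has tensor rank `≥ 2q` (MIZUTANI-PROOF-g59 §2/§9).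
[cite: Mizutani1973HironakaGroupSchemes, Remark 2.10 (in-house proof §2 / §9, THEOREM F)] -/
theorem theoremF_rank_of_boxBridge [Fact p.Prime] [CharP k p] [Infinite L] [FiniteDimensional L k]
    (B : BoxTowerBridge L k p e s) (hs : 2 ≤ s) (he : 1 ≤ e) (ω : k ⊗[L] k)
    (hdeg : ∀ M ∈ (B.Ω ω).support, p ^ e ≤ M.degree) (hgen : ∃ M ∈ (B.Ω ω).support, IsGenuine p e M) :
    2 * p ^ e ≤ tensorRank L ω := by
  have hp : 0 < p := (Fact.out : p.Prime).pos
  have hq : 1 ≤ p ^ e := Nat.one_le_pow _ _ hp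
  have hgood : GoodOps (algebraMap L k).range (fun T => (B.D T).toAddMonoidHom) := by
    refine ⟨?_, ?_⟩
    · ext x
      simp [B.D_zero]
    · rintro c ⟨l, rfl⟩ T x
      show B.D T (algebraMap L k l * x) = algebraMap L k l * B.D T x
      rw [← Algebra.smul_def, ← Algebra.smul_def, LinearMap.map_smul]
  have hinf : ((algebraMap L k).range : Set k).Infinite := by
    have : ((algebraMap L k).range : Set k) = Set.range (algebraMap L k) := rfl
    rw [this]
    exact Set.infinite_range_of_injective (algebraMap L k).injective
  have hω : ω ≠ 0 := by
    obtain ⟨M, hM, -⟩ := hgen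
    rintro rfl
    rw [map_zero, support_zero] at hM
    exact absurd hM (Finset.notMem_empty M)
  have hadm : ∀ M ∈ (B.Ω ω).support, InBox (p ^ e) M ∧ p ^ e ≤ M.degree :=
    fun M hM => ⟨B.Ω_box ω M hM, hdeg M hM⟩
  have h1 := profile_theorem (p := p) (e := e) (algebraMap L k).range hinf he s hs
    (fun T => (B.D T).toAddMonoidHom) (B.Ω ω) hgood hadm hgen (p ^ e - 1) (by omega)
  have h2 := eProfile_succ_le_tensorRank_of_le B.D B.Ω hq B.Ω_map B.Ω_coeff_zero ω hω hdeg
  omega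

end BoxVersions

end Summit.ResolutionOfSingularities.KangarooAtlas.Mizutani
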